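import Mathlib
import Summits.Ventures.HodgeRepro2.LevelPositivity
import Summits.Ventures.HodgeRepro2.LevelBaseChange

/-!
# Non-vanishing of `Hom` from the existence half alone

Kernel annex of sub-claim B5 (single-level positivity + level), file 7 — the answer to ref-2's
non-blocking note N-EXT.1 (STATUS 00:37:52Z): the conclusion of Theorem B5.1(iv) that is used
downstream, `Hom_E(A_{K'}, A_{μ_i}) ≠ 0`, needs of the printed isomorphism of Liu 2021 Thm. 4.18
only its EXISTENCE half — a `G`-equivariant INJECTION `ω(μ_i, ε_i, χ_i) ↪ Ω(μ_i) ⊗_{M̃_μ} ℂ` — and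
not the exhaustion / multiplicity-one half (the half of the proof of Prop. 4.13 that imports
Bergeron–Millson–Moeglin). No dimension count is involved: a non-zero `K'`-invariant vector of
`ω_i` maps to a non-zero `K'`-invariant vector of `Ω ⊗ ℂ`, whose `K'`-invariants are the base
change of `Ω^{K'}` (file 2, `invariants_baseChange`), so `Ω^{K'} ≠ 0`, and the printed `ℚ`-linear
isomorphism `Ω^{K'} ≃ Hom` (Thm. 4.18(1)) gives `Hom ≠ 0`. Everything printed enters as a
hypothesis (`ι`, `hι`, `hequiv`, `f`).

* `mem_invariants_of_equivariant` — an equivariant map sends `K'`-invariants to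
  `K'`-invariants.
* `invariants_ne_bot_of_baseChange` — if the base change `C ⊗_M V` has a non-zero `K'`-invariant
  vector, then `V^{K'} ≠ ⊥` (`M`, `C` fields).
* `exists_ne_zero_of_existence_half` — the statement above: from an injective equivariant
  `ι : W → C ⊗_M V`, a non-zero `w ∈ W^{K'}`, and any `Q`-linear isomorphism `f : V^{K'} ≃ H`,
  `H` has a non-zero element.
-/

namespace Summit.Ventures.HodgeRepro2.LevelPositivity

open TensorProduct

variable {G : Type*} [Group G]

section Equivariant

variable {k : Type*} [Field k] {V W : Type*} [AddCommGroup V] [Module k V] [AddCommGroup W]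
  [Module k W]

/-- An equivariant linear map sends `K'`-invariant vectors to `K'`-invariant vectors. -/
theorem mem_invariants_of_equivariant (ρW : Representation k G W)
    (ρV : Representation k G V) (ι : W →ₗ[k] V) (hequiv : ∀ g w, ι (ρW g w) = ρV g (ι w))
    (K' : Subgroup G) {w : W} (hw : w ∈ invariants ρW K') : ι w ∈ invariants ρV K' := by
  rw [mem_invariants_iff] at hw ⊢
  intro g hg
  rw [← hequiv, hw g hg]

end Equivariant

section BaseChange

variable {M C : Type*} [Field M] [Field C] [Algebra M C] {V : Type*} [AddCommGroup V] [Module M V]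

/-- If the base change `C ⊗_M V` has a non-zero `K'`-invariant vector, then `V^{K'} ≠ ⊥`:
the `K'`-invariants of the base change are the base change of the `K'`-invariants (file 2), and
the base change of `⊥` is `⊥`. -/
theorem invariants_ne_bot_of_baseChange (Ω : Representation M G V) (K' : Subgroup G) {x : C ⊗[M] V}
    (hx : x ∈ invariants (baseChangeRep (C := C) Ω) K') (hx0 : x ≠ 0) :
    invariants Ω K' ≠ ⊥ := by
  intro hbot
  apply hx0
  have hrestr : restrict (baseChangeRep (C := C) Ω) K' = baseChangeRep (restrict Ω K') :=
    MonoidHom.ext fun _ => rfl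
  have hx' : x ∈ (baseChangeRep (restrict Ω K')).invariants := by
    unfold invariants at hx
    rwa [hrestr] at hx
  rw [invariants_baseChange] at hx'
  unfold invariants at hbot
  rw [hbot, Submodule.baseChange_bot] at hx'
  exact (Submodule.mem_bot C).1 hx'

end BaseChange

section ExistenceHalf

variable {Q M C : Type*} [Field Q] [Field M] [Field C] [Algebra Q M] [Algebra M C]
variable {V : Type*} [AddCommGroup V] [Module M V] [Module Q V] [IsScalarTower Q M V]

/-- The existence half suffices for `Hom ≠ 0`. Hypotheses: `Ω` an `M`-representation of `G`
(Liu: `Ω(μ_i)` over `M̃_{μ_i}`); `ρW` a `C`-representation (`ω(μ_i, ε_i, χ_i)` over `ℂ`);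
`ι : W → C ⊗_M V` an injective `G`-equivariant `C`-linear map (the EXISTENCE half of Thm. 4.18:
`ω(μ_i, ε_i, χ_i)` occurs in `Ω(μ_i) ⊗ ℂ`); `w` a non-zero `K'`-invariant vector of `W`
(Step 2 of the proof of Theorem B5.1); `f : V^{K'} ≃ H` any `Q`-linear isomorphism
(Thm. 4.18(1) with `H = Hom_E(A_{K'}, A_{μ_i})_ℚ`, `Q = ℚ`). Conclusion: `H ≠ 0`. Neither the
exhaustion half of Thm. 4.18 nor any dimension count is used. -/
theorem exists_ne_zero_of_existence_half (Ω : Representation M G V) {W : Type*} [AddCommGroup W]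
    [Module C W] (ρW : Representation C G W) (ι : W →ₗ[C] (C ⊗[M] V))
    (hι : Function.Injective ι) (hequiv : ∀ g w, ι (ρW g w) = baseChangeRep Ω g (ι w))
    (K' : Subgroup G) {w : W} (hw : w ∈ invariants ρW K') (hw0 : w ≠ 0) {H : Type*}
    [AddCommGroup H] [Module Q H] (f : invariants Ω K' ≃ₗ[Q] H) : ∃ h : H, h ≠ 0 := by
  have hιw : ι w ∈ invariants (baseChangeRep (C := C) Ω) K' :=
    mem_invariants_of_equivariant ρW (baseChangeRep Ω) ι hequiv K' hw
  have hιw0 : ι w ≠ 0 := fun h => hw0 (hι (by rw [h, map_zero]))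
  have hne : invariants Ω K' ≠ ⊥ := invariants_ne_bot_of_baseChange Ω K' hιw hιw0
  obtain ⟨v, hv, hv0⟩ := (Submodule.ne_bot_iff _).1 hne
  refine ⟨f ⟨v, hv⟩, ?_⟩
  intro h0
  apply hv0
  have : (⟨v, hv⟩ : invariants Ω K') = 0 := f.injective (by rw [h0, map_zero])
  exact congrArg Subtype.val this

/-- The same conclusion phrased for the `Q`-vector space `V^{K'}` itself (no `f`): the existence
half gives a non-zero `K'`-invariant vector of `Ω`. -/
theorem exists_invariant_ne_zero_of_existence_half (Ω : Representation M G V) {W : Type*}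
    [AddCommGroup W] [Module C W] (ρW : Representation C G W) (ι : W →ₗ[C] (C ⊗[M] V))
    (hι : Function.Injective ι) (hequiv : ∀ g w, ι (ρW g w) = baseChangeRep Ω g (ι w))
    (K' : Subgroup G) {w : W} (hw : w ∈ invariants ρW K') (hw0 : w ≠ 0) :
    ∃ v ∈ invariants Ω K', v ≠ 0 := by
  have hιw : ι w ∈ invariants (baseChangeRep (C := C) Ω) K' :=
    mem_invariants_of_equivariant ρW (baseChangeRep Ω) ι hequiv K' hw
  have hιw0 : ι w ≠ 0 := fun h => hw0 (hι (by rw [h, map_zero]))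
  exact (Submodule.ne_bot_iff _).1 (invariants_ne_bot_of_baseChange Ω K' hιw hιw0)

end ExistenceHalf

end Summit.Ventures.HodgeRepro2.LevelPositivity
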